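/-
Copyright (c) 2026 the pub-hodgecm-mathlib formalisation cell (harness21).  Prover seat hodgecm-mathlib-A-p19 (g20), topic T5 = P8
«(C♯)hol interior», node C∞ brick (P3) «ball geometry of a diagonalising frame on the torus» (desk F0P2-plan (g9) 23:23Z).
KERNEL module: THEOREMS ONLY (no definition, no named fact, no `sorry`, no instance, no notation).
-/
import Literature.Geometry.ComplexHyperbolic.UnitBallIsotropyBlock
import HarnessLib

/-!
# A frame `C` with `Cᴴ J C = diag(d)`: the torus `C · diag(s) · C⁻¹ ⊂ U(2,1)`, its fixed point `x₁ = [C e_{p₋}]`, and the eigenvectors of its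
# isotropy Jacobian at `x₀` after transport by `h x₀ = x₁` ([Helgason1978, Ch. VIII §7]; [BorelWallach2000, VI 4.7]; [Jacobowitz1990, Ch. 2 §1])

Topic `Geometry/ComplexHyperbolic`; namespace `Literature.Geometry.ComplexHyperbolic.BallModel` (the tree's ball model: ★ `J`, `U21`, `Ball`, `x₀`, `proj`,
`Jac`, `ulBlock`).  KERNEL: theorems only.  Cell hodgecm-mathlib FLOOR 0, programme P2, topic T5 = P8 «(C♯)hol interior», node **C∞**
([Liu2021, Lem. D.2 (2)] at the place of `ι`), brick (P3) of the road «K-type of `(1,0)`-forms» (siblings: ★ FILE 1 `Liu2021/ThetaLiftFromLineEquivariantFunctional`,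
★ (W1) `GelbartRogawski1991/DoubledWeilRepresentationArchPlacePhaseBlock`, (P2) `Liu2021/ThetaLiftFromLineFrameArchProj`).

THE GEOMETRY.  Let `C ∈ GL₃(ℂ)` with `Cᴴ J C = diag(d)`, `d` real (in node C∞: `C = T⁻¹ · ι(g)`, `d = σ_{v(ι)}(dV)`, from `Tᴴ ι(H) T = J` and
`ḡᵀ H g = diag dV`).  For `s ∈ (S¹)³` the matrix `C · diag(s) · C⁻¹` preserves `J` (§2), so defines `t_s ∈ U(2,1)`; the columns `C e_p` are pairwise
`J`-orthogonal with `Q(C e_p) = d_p` (§1).  One `d_{p₋}` is negative (§1, `Q(e₃) = −1`) and then the other two are positive (§1, a two-line Sylvester: a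
`J`-negative `J`-orthogonal pair would produce a non-zero vector of `ℂ² × 0` of non-positive norm); `x₁ := [C e_{p₋}] ∈ 𝔹²` is FIXED by every `t_s`
(§3).  With `h ∈ U(2,1)`, `h x₀ = x₁` (★ `exists_smul_x₀_eq`), `k_s := h⁻¹ t_s h ∈ Stab(x₀)` and `P := (mat h)⁻¹ C` satisfies `mat(k_s) · P = P · diag(s)`
(§4); `P e_{p₋} ∈ ℂ e₃` (because `h⁻¹ x₁ = x₀`) and `P e_p ∈ ℂ² × 0` for `p ≠ p₋` (`J`-orthogonality), so `mat(k_s)₂₂ = s_{p₋}` and the `2 × 2` matrix `V`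
of the first two coordinates of `P e_{p₁}, P e_{p₂}` (`{p₁, p₂, p₋} = Fin 3`) is INVERTIBLE with `ulBlock(k_s) · V = V · diag(s_{p₁}, s_{p₂})` (§5); hence the
isotropy Jacobian `Jac k_s x₀ = (mat(k_s)₂₂)⁻¹ • ulBlock k_s` (§5, [BorelWallach2000, VI 4.7]: `diag(A,d) ↦ d⁻¹ A`) is diagonalised by the FIXED frame `V`
with eigenvalues `s_{p₁} s_{p₋}⁻¹`, `s_{p₂} s_{p₋}⁻¹` for ALL `s` at once:

  **`Jac_frameTorus_conj_mul_eq`**: `Jac k_s x₀ * V = V * diagonal ![s p₁ * (s p₋)⁻¹, s p₂ * (s p₋)⁻¹]`.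

§6 is the linear-algebra read-out used by the node-C∞ closer: a vector `x ≠ 0` with `Jac k_s x₀ *ᵥ x = χ(s) • x` for all `s` has `χ = s_{p_j} s_{p₋}⁻¹` for
ONE `j` and all `s` (`y := V⁻¹ x` has a non-zero coordinate), and two torus characters `∏ (s p)^{n p}` that agree on `(S¹)³` have equal exponents
(roots of unity of large order, Mathlib `IsPrimitiveRoot`).

HONEST SCOPE.  Elementary matrix algebra in the tree's ball model; nothing of [Liu2021] is asserted.  HC_CM is proved only modulo the printed citations until
rung 0 closes; this file books nothing and discharges nothing booked.

## References
* [Helgason1978] S. Helgason, *Differential Geometry, Lie Groups, and Symmetric Spaces* (1978), Ch. VIII §7 (isotropy representation).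
* [BorelWallach2000] A. Borel, N. Wallach (2000), VI 4.7 (`K = U(2) × U(1)`, `𝔭₊`).
* [Jacobowitz1990] H. Jacobowitz, *An Introduction to CR Structures*, AMS (1990), Ch. 2 §1 Lemma 6 (the action of `U(2,1)` on `𝔹²`, stabiliser of `0`).
* [HornJohnson2013] R. A. Horn, C. R. Johnson, *Matrix Analysis*, 2nd ed. (2013), §0.5, §1.3 (Def. 1.3.11, Thm. 1.3.21).
* [BrockerTomDieck1985] T. Bröcker, T. tom Dieck, *Representations of Compact Lie Groups*, GTM 98 (1985), II Prop. 8.1.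
* [Liu2021] Y. Liu, Camb. J. Math. 9 (2021), App. D Lem. D.2 (2) — the consumer.
-/

set_option autoImplicit false

noncomputable section

open Matrix MulAction
open scoped ComplexConjugate

namespace Literature.Geometry.ComplexHyperbolic

namespace BallModel

variable (C : GL3) (d : Fin 3 → ℝ) (hC : ((C : Matrix (Fin 3) (Fin 3) ℂ))ᴴ * J * (C : Matrix (Fin 3) (Fin 3) ℂ) = Matrix.diagonal fun p => ((d p : ℝ) : ℂ))

/-! ## §1 The columns of the frame: `Q(C e_p) = d_p`, `J`-orthogonality, one negative and two positive `d_p` -/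

include hC in
/-- the sesquilinear form on two columns of the frame is the corresponding entry of `diag(d)`. [cite: Jacobowitz1990, Ch. 2 §1 (p. 40)] -/
theorem star_col_dotProduct_J_mulVec_col (p q : Fin 3) :
    star (fun i => (C : Matrix (Fin 3) (Fin 3) ℂ) i p) ⬝ᵥ (J *ᵥ fun i => (C : Matrix (Fin 3) (Fin 3) ℂ) i q) =
      (Matrix.diagonal fun p => ((d p : ℝ) : ℂ)) p q := by
  rw [← hC]
  simp only [Matrix.mul_apply, Matrix.conjTranspose_apply, dotProduct, Matrix.mulVec, Pi.star_apply, Finset.sum_mul, Finset.mul_sum]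
  rw [Finset.sum_comm]
  simp only [mul_assoc]

include hC in
/-- **`Q(C e_p) = d_p`.** [cite: Jacobowitz1990, Ch. 2 §1 (p. 40)] -/
theorem Q_col_eq (p : Fin 3) : Q (fun i => (C : Matrix (Fin 3) (Fin 3) ℂ) i p) = d p := by
  have h := star_col_dotProduct_J_mulVec_col C d hC p p
  rw [form_eq_Q, Matrix.diagonal_apply_eq] at h
  exact_mod_cast h

include hC in
/-- **some `d_p` is negative**: `e₃ = C (C⁻¹ e₃)` has `Q(e₃) = −1 = Σ_p d_p |x_p|²`. [cite: Jacobowitz1990, Ch. 2 §1 (p. 40)] -/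
theorem exists_neg : ∃ p, d p < 0 := by
  by_contra hcon
  push Not at hcon
  -- `Q(C x) = Σ d_p |x_p|²` for every `x`
  set x : Fin 3 → ℂ := ((C⁻¹ : GL3) : Matrix (Fin 3) (Fin 3) ℂ) *ᵥ Pi.single 2 1 with hx
  have hCx : (C : Matrix (Fin 3) (Fin 3) ℂ) *ᵥ x = Pi.single 2 1 := by
    rw [hx, Matrix.mulVec_mulVec, ← Units.val_mul, mul_inv_cancel, Units.val_one, Matrix.one_mulVec]
  have hform : star ((C : Matrix (Fin 3) (Fin 3) ℂ) *ᵥ x) ⬝ᵥ (J *ᵥ ((C : Matrix (Fin 3) (Fin 3) ℂ) *ᵥ x)) =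
      ∑ p, ((d p : ℝ) : ℂ) * (star (x p) * x p) := by
    rw [Matrix.star_mulVec, Matrix.mulVec_mulVec, Matrix.dotProduct_mulVec, Matrix.vecMul_vecMul, ← Matrix.mul_assoc, hC]
    simp only [dotProduct, Matrix.vecMul_diagonal, Pi.star_apply]
    refine Finset.sum_congr rfl fun p _ => ?_
    ring
  rw [hCx, form_eq_Q] at hform
  have hQ : Q (Pi.single (2 : Fin 3) (1 : ℂ)) = -1 := by
    simp [Q]
  rw [hQ] at hform
  have hre : (-1 : ℝ) = ∑ p, d p * ‖x p‖ ^ 2 := by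
    have h := congrArg Complex.re hform
    simp only [Complex.ofReal_neg, Complex.ofReal_one, Complex.neg_re, Complex.one_re, Complex.re_sum] at h
    rw [h]
    refine Finset.sum_congr rfl fun p _ => ?_
    rw [Complex.star_def, Complex.conj_mul', ← Complex.ofReal_pow, ← Complex.ofReal_mul, Complex.ofReal_re]
  have hnn : 0 ≤ ∑ p, d p * ‖x p‖ ^ 2 := Finset.sum_nonneg fun p _ => mul_nonneg (hcon p) (sq_nonneg _)
  linarith

include hC in
/-- **the other two `d_p` are positive**: if `d_{p₋} < 0` and `p ≠ p₋` then `0 < d_p` — the `J`-orthogonal `J`-negative pair `C e_p, C e_{p₋}` would combine to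
a non-zero vector with vanishing last coordinate and non-positive `Q` (a two-line Sylvester). [cite: Jacobowitz1990, Ch. 2 §1 (p. 40)] -/
theorem pos_of_ne {pm : Fin 3} (hpm : d pm < 0) {p : Fin 3} (hp : p ≠ pm) : 0 < d p := by
  by_contra hle
  push Not at hle
  set x : Fin 3 → ℂ := fun i => (C : Matrix (Fin 3) (Fin 3) ℂ) i p with hx
  set y : Fin 3 → ℂ := fun i => (C : Matrix (Fin 3) (Fin 3) ℂ) i pm with hy
  have hxx : star x ⬝ᵥ (J *ᵥ x) = ((d p : ℝ) : ℂ) := by rw [hx, star_col_dotProduct_J_mulVec_col C d hC, Matrix.diagonal_apply_eq]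
  have hyy : star y ⬝ᵥ (J *ᵥ y) = ((d pm : ℝ) : ℂ) := by rw [hy, star_col_dotProduct_J_mulVec_col C d hC, Matrix.diagonal_apply_eq]
  have hxy : star x ⬝ᵥ (J *ᵥ y) = 0 := by rw [hx, hy, star_col_dotProduct_J_mulVec_col C d hC, Matrix.diagonal_apply_ne _ hp]
  have hyx : star y ⬝ᵥ (J *ᵥ x) = 0 := by rw [hx, hy, star_col_dotProduct_J_mulVec_col C d hC, Matrix.diagonal_apply_ne _ (Ne.symm hp)]
  -- the explicit form
  have hform : ∀ u w : Fin 3 → ℂ, star u ⬝ᵥ (J *ᵥ w) = star (u 0) * w 0 + star (u 1) * w 1 - star (u 2) * w 2 := fun u w => by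
    simp only [J, mulVec_diagonal, dotProduct, Fin.sum_univ_three, Pi.star_apply, Matrix.cons_val_zero, Matrix.cons_val_one, Matrix.cons_val]
    ring
  -- `v := y₂ • x − x₂ • y` has `v₂ = 0`, and `Q(v) = |y₂|² d_p + |x₂|² d_{p₋} ≤ 0`
  set v : Fin 3 → ℂ := fun i => y 2 * x i - x 2 * y i with hv
  have hv2 : v 2 = 0 := by rw [hv]; ring
  have hQv : star v ⬝ᵥ (J *ᵥ v) = star (y 2) * y 2 * ((d p : ℝ) : ℂ) + star (x 2) * x 2 * ((d pm : ℝ) : ℂ) := by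
    rw [hform] at hxx hyy hxy hyx ⊢
    simp only [hv, star_sub, star_mul]
    linear_combination star (y 2) * y 2 * hxx + star (x 2) * x 2 * hyy - star (y 2) * x 2 * hxy - star (x 2) * y 2 * hyx
  have hQv' : star v ⬝ᵥ (J *ᵥ v) = star (v 0) * v 0 + star (v 1) * v 1 := by rw [hform, hv2, star_zero, zero_mul, sub_zero]
  -- real parts
  have h1 : (‖y 2‖ ^ 2 * d p + ‖x 2‖ ^ 2 * d pm : ℝ) = ‖v 0‖ ^ 2 + ‖v 1‖ ^ 2 := by
    have h := hQv.symm.trans hQv'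
    have h' := congrArg Complex.re h
    simp only [Complex.star_def, Complex.conj_mul', Complex.add_re, Complex.mul_re, Complex.ofReal_re, Complex.ofReal_im, mul_zero, sub_zero,
      ← Complex.ofReal_pow] at h'
    linarith
  have hyneg : ‖y 2‖ ^ 2 * d p ≤ 0 := mul_nonpos_of_nonneg_of_nonpos (sq_nonneg _) hle
  have hxneg : ‖x 2‖ ^ 2 * d pm ≤ 0 := mul_nonpos_of_nonneg_of_nonpos (sq_nonneg _) hpm.le
  have hv0 : ‖v 0‖ ^ 2 + ‖v 1‖ ^ 2 = 0 := by nlinarith [sq_nonneg ‖v 0‖, sq_nonneg ‖v 1‖]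
  have hx2 : ‖x 2‖ ^ 2 * d pm = 0 := by linarith
  have hx2' : x 2 = 0 := by
    rcases mul_eq_zero.mp hx2 with h | h
    · exact norm_eq_zero.mp (pow_eq_zero_iff (two_ne_zero) |>.mp h)
    · exact absurd h hpm.ne
  -- then `Q(x) = |x₀|² + |x₁|² = d_p ≤ 0`, so `x = 0`: a zero column of an invertible matrix
  have hQx : (‖x 0‖ ^ 2 + ‖x 1‖ ^ 2 : ℝ) = d p := by
    have h := hxx
    rw [hform, hx2', star_zero, zero_mul, sub_zero] at h
    have h' := congrArg Complex.re h
    simp only [Complex.star_def, Complex.conj_mul', Complex.add_re, Complex.ofReal_re, ← Complex.ofReal_pow] at h'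
    linarith
  have hx0 : x 0 = 0 := by
    have : ‖x 0‖ ^ 2 = 0 := by nlinarith [sq_nonneg ‖x 0‖, sq_nonneg ‖x 1‖]
    exact norm_eq_zero.mp (pow_eq_zero_iff two_ne_zero |>.mp this)
  have hx1 : x 1 = 0 := by
    have : ‖x 1‖ ^ 2 = 0 := by nlinarith [sq_nonneg ‖x 0‖, sq_nonneg ‖x 1‖]
    exact norm_eq_zero.mp (pow_eq_zero_iff two_ne_zero |>.mp this)
  have hxz : x = 0 := by
    funext i; fin_cases i
    · exact hx0
    · exact hx1
    · exact hx2'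
  -- `C (C⁻¹ row) = 1` contradicts the zero column
  have hcol : ((C⁻¹ : GL3) : Matrix (Fin 3) (Fin 3) ℂ) * (C : Matrix (Fin 3) (Fin 3) ℂ) = 1 := by
    rw [← Units.val_mul, inv_mul_cancel, Units.val_one]
  have h11 : (((C⁻¹ : GL3) : Matrix (Fin 3) (Fin 3) ℂ) * (C : Matrix (Fin 3) (Fin 3) ℂ)) p p = 1 := by rw [hcol, Matrix.one_apply_eq]
  rw [Matrix.mul_apply] at h11
  have h0 : ∑ k, ((C⁻¹ : GL3) : Matrix (Fin 3) (Fin 3) ℂ) p k * (C : Matrix (Fin 3) (Fin 3) ℂ) k p = 0 :=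
    Finset.sum_eq_zero fun k _ => by rw [show (C : Matrix (Fin 3) (Fin 3) ℂ) k p = x k from rfl, hxz, Pi.zero_apply, mul_zero]
  rw [h0] at h11
  exact zero_ne_one h11

/-! ## §2 The torus `C · diag(s) · C⁻¹ ⊂ U(2,1)` -/

include hC in
/-- **`C · diag(s) · C⁻¹` preserves `J`** for `|s_p| = 1`: `J = C⁻ᴴ diag(d) C⁻¹` and diagonal matrices commute. [cite: Jacobowitz1990, Ch. 2 §1 (p. 40)] -/
theorem frameTorus_mem (s : Fin 3 → ℂ) (hs : ∀ p, star (s p) * s p = 1) :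
    ((C : Matrix (Fin 3) (Fin 3) ℂ) * Matrix.diagonal s * ((C⁻¹ : GL3) : Matrix (Fin 3) (Fin 3) ℂ))ᴴ * J *
        ((C : Matrix (Fin 3) (Fin 3) ℂ) * Matrix.diagonal s * ((C⁻¹ : GL3) : Matrix (Fin 3) (Fin 3) ℂ)) = J := by
  have hinv : (C : Matrix (Fin 3) (Fin 3) ℂ) * ((C⁻¹ : GL3) : Matrix (Fin 3) (Fin 3) ℂ) = 1 := by
    rw [← Units.val_mul, mul_inv_cancel, Units.val_one]
  have hinv' : ((C⁻¹ : GL3) : Matrix (Fin 3) (Fin 3) ℂ) * (C : Matrix (Fin 3) (Fin 3) ℂ) = 1 := by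
    rw [← Units.val_mul, inv_mul_cancel, Units.val_one]
  -- `J = C⁻ᴴ diag(d) C⁻¹`
  have hJ : J = ((C⁻¹ : GL3) : Matrix (Fin 3) (Fin 3) ℂ)ᴴ * Matrix.diagonal (fun p => ((d p : ℝ) : ℂ)) * ((C⁻¹ : GL3) : Matrix (Fin 3) (Fin 3) ℂ) := by
    rw [← hC]
    calc J = (((C : Matrix (Fin 3) (Fin 3) ℂ) * ((C⁻¹ : GL3) : Matrix (Fin 3) (Fin 3) ℂ))ᴴ) * J *
          ((C : Matrix (Fin 3) (Fin 3) ℂ) * ((C⁻¹ : GL3) : Matrix (Fin 3) (Fin 3) ℂ)) := by rw [hinv, Matrix.conjTranspose_one, Matrix.one_mul, Matrix.mul_one]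
      _ = _ := by simp only [Matrix.conjTranspose_mul, Matrix.mul_assoc]
  have hdiag : Matrix.diagonal (star s) * Matrix.diagonal (fun p => ((d p : ℝ) : ℂ)) * Matrix.diagonal s =
      Matrix.diagonal (fun p => ((d p : ℝ) : ℂ)) := by
    rw [Matrix.diagonal_mul_diagonal, Matrix.diagonal_mul_diagonal]
    congr 1
    funext p
    rw [Pi.star_apply, mul_comm (star (s p)), mul_assoc, hs p, mul_one]
  rw [Matrix.conjTranspose_mul, Matrix.conjTranspose_mul, Matrix.diagonal_conjTranspose]
  calc ((C⁻¹ : GL3) : Matrix (Fin 3) (Fin 3) ℂ)ᴴ * ((Matrix.diagonal (star s)) * (C : Matrix (Fin 3) (Fin 3) ℂ)ᴴ) * J *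
        ((C : Matrix (Fin 3) (Fin 3) ℂ) * Matrix.diagonal s * ((C⁻¹ : GL3) : Matrix (Fin 3) (Fin 3) ℂ))
      = ((C⁻¹ : GL3) : Matrix (Fin 3) (Fin 3) ℂ)ᴴ * (Matrix.diagonal (star s) *
          ((C : Matrix (Fin 3) (Fin 3) ℂ)ᴴ * J * (C : Matrix (Fin 3) (Fin 3) ℂ)) * Matrix.diagonal s) *
          ((C⁻¹ : GL3) : Matrix (Fin 3) (Fin 3) ℂ) := by simp only [Matrix.mul_assoc]
    _ = J := by rw [hC, hdiag, ← hJ]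

/-- the torus element acts on the column `C e_p` by the scalar `s_p`. [folklore] -/
private theorem frameTorus_mulVec_col (s : Fin 3 → ℂ) (p : Fin 3) :
    ((C : Matrix (Fin 3) (Fin 3) ℂ) * Matrix.diagonal s * ((C⁻¹ : GL3) : Matrix (Fin 3) (Fin 3) ℂ)) *ᵥ
        (fun i => (C : Matrix (Fin 3) (Fin 3) ℂ) i p) = s p • fun i => (C : Matrix (Fin 3) (Fin 3) ℂ) i p := by
  have hinv' : ((C⁻¹ : GL3) : Matrix (Fin 3) (Fin 3) ℂ) * (C : Matrix (Fin 3) (Fin 3) ℂ) = 1 := by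
    rw [← Units.val_mul, inv_mul_cancel, Units.val_one]
  have hcol : (fun i => (C : Matrix (Fin 3) (Fin 3) ℂ) i p) = (C : Matrix (Fin 3) (Fin 3) ℂ) *ᵥ Pi.single p 1 := by
    funext i
    rw [Matrix.mulVec, dotProduct, Finset.sum_eq_single p (fun k _ hk => by rw [Pi.single_eq_of_ne hk, mul_zero])
      (fun h => absurd (Finset.mem_univ p) h), Pi.single_eq_same, mul_one]
  have h1 : Matrix.diagonal s *ᵥ Pi.single p (1 : ℂ) = s p • Pi.single p 1 := by
    funext i
    rw [Matrix.mulVec_diagonal, Pi.smul_apply, smul_eq_mul]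
    by_cases hi : i = p
    · subst hi; rfl
    · rw [Pi.single_eq_of_ne hi, mul_zero, mul_zero]
  rw [hcol, Matrix.mulVec_mulVec, Matrix.mul_assoc, Matrix.mul_assoc, hinv', Matrix.mul_one, ← Matrix.mulVec_mulVec, h1,
    Matrix.mulVec_smul]

/-! ## §3 The fixed point `x₁ = [C e_{p₋}]` -/

include hC in
/-- `Q(C e_{p₋}) < 0` when `d_{p₋} < 0`: the column defines a point of the ball. [cite: Jacobowitz1990, Ch. 2 §1 (p. 40)] -/
theorem Q_col_neg {pm : Fin 3} (hpm : d pm < 0) : Q (fun i => (C : Matrix (Fin 3) (Fin 3) ℂ) i pm) < 0 := by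
  rw [Q_col_eq C d hC]; exact hpm

/-- `lift (proj w) = w₂⁻¹ • w`. [cite: Jacobowitz1990, Ch. 2 §1 (p. 40)] -/
theorem lift_proj (w : Fin 3 → ℂ) (hw : Q w < 0) : lift (proj w hw) = (w 2)⁻¹ • w := by
  have h2 := ne_zero_of_Q_neg hw
  funext k
  fin_cases k
  · simp [div_eq_inv_mul]
  · simp [div_eq_inv_mul]
  · simp [h2]

include hC in
/-- **the torus FIXES `x₁ = [C e_{p₋}]`**: `(C diag(s) C⁻¹) • proj (C e_{p₋}) = proj (C e_{p₋})` (`C e_{p₋}` is an eigenvector).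
[cite: Jacobowitz1990, Ch. 2 §1 Lemma 6] -/
theorem frameTorus_smul_proj_col {pm : Fin 3} (hpm : d pm < 0) (s : Fin 3 → ℂ) (hs : ∀ p, star (s p) * s p = 1) :
    mkU21 _ (frameTorus_mem C d hC s hs) • proj _ (Q_col_neg C d hC hpm) = proj _ (Q_col_neg C d hC hpm) := by
  have hsp : s pm ≠ 0 := fun h => by have := hs pm; rw [h, mul_zero] at this; exact zero_ne_one this
  have h2 := ne_zero_of_Q_neg (Q_col_neg C d hC hpm)
  have hW : W3 (mkU21 _ (frameTorus_mem C d hC s hs)) (proj _ (Q_col_neg C d hC hpm)) =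
      (((C : Matrix (Fin 3) (Fin 3) ℂ) 2 pm)⁻¹ * s pm) • fun i => (C : Matrix (Fin 3) (Fin 3) ℂ) i pm := by
    rw [W3, mat_mkU21, lift_proj, Matrix.mulVec_smul, frameTorus_mulVec_col, smul_smul]
  apply Ball.ext
  intro i
  rw [smul_val, hW, proj_val, Pi.smul_apply, Pi.smul_apply, smul_eq_mul, smul_eq_mul,
    mul_div_mul_left _ _ (mul_ne_zero (inv_ne_zero h2) hsp)]

/-! ## §4 Transport to the base point: `k_s = h⁻¹ t_s h ∈ Stab(x₀)` and `mat(k_s) · P = P · diag(s)`, `P = (mat h)⁻¹ C` -/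

section Transport

variable {pm : Fin 3} (hpm : d pm < 0) (h : U21) (hh : h • x₀ = proj _ (Q_col_neg C d hC hpm))

include hh in
/-- `k_s := h⁻¹ · t_s · h` fixes the base point. [cite: Jacobowitz1990, Ch. 2 §1 Lemma 6] -/
theorem conj_frameTorus_smul_x₀ (s : Fin 3 → ℂ) (hs : ∀ p, star (s p) * s p = 1) :
    (h⁻¹ * mkU21 _ (frameTorus_mem C d hC s hs) * h) • x₀ = x₀ := by
  rw [mul_smul, mul_smul, hh, frameTorus_smul_proj_col C d hC hpm s hs, ← hh, inv_smul_smul]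

/-- **`mat(k_s) · P = P · diag(s)`** with `P = mat(h⁻¹) · C`. [cite: Jacobowitz1990, Ch. 2 §1 Lemma 6] -/
theorem mat_conj_frameTorus_mul (s : Fin 3 → ℂ) (hs : ∀ p, star (s p) * s p = 1) :
    mat (h⁻¹ * mkU21 _ (frameTorus_mem C d hC s hs) * h) * (mat h⁻¹ * (C : Matrix (Fin 3) (Fin 3) ℂ)) =
      (mat h⁻¹ * (C : Matrix (Fin 3) (Fin 3) ℂ)) * Matrix.diagonal s := by
  have hinv' : ((C⁻¹ : GL3) : Matrix (Fin 3) (Fin 3) ℂ) * (C : Matrix (Fin 3) (Fin 3) ℂ) = 1 := by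
    rw [← Units.val_mul, inv_mul_cancel, Units.val_one]
  have hhh : mat h * mat h⁻¹ = 1 := by rw [← mat_mul, mul_inv_cancel, mat_one]
  rw [mat_mul, mat_mul, mat_mkU21]
  calc mat h⁻¹ * ((C : Matrix (Fin 3) (Fin 3) ℂ) * Matrix.diagonal s * ((C⁻¹ : GL3) : Matrix (Fin 3) (Fin 3) ℂ)) * mat h *
        (mat h⁻¹ * (C : Matrix (Fin 3) (Fin 3) ℂ))
      = mat h⁻¹ * (C : Matrix (Fin 3) (Fin 3) ℂ) * Matrix.diagonal s *
          (((C⁻¹ : GL3) : Matrix (Fin 3) (Fin 3) ℂ) * ((mat h * mat h⁻¹) * (C : Matrix (Fin 3) (Fin 3) ℂ))) := by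
        simp only [Matrix.mul_assoc]
    _ = mat h⁻¹ * (C : Matrix (Fin 3) (Fin 3) ℂ) * Matrix.diagonal s := by rw [hhh, Matrix.one_mul, hinv', Matrix.mul_one]

include hh in
/-- **the column `P e_{p₋}` lies on the axis `ℂ e₃`**: its first two coordinates vanish, because `h⁻¹ x₁ = x₀ = 0`. [cite: Jacobowitz1990, Ch. 2 §1 Lemma 6] -/
theorem transport_col_neg_apply_castSucc (i : Fin 2) :
    (mat h⁻¹ * (C : Matrix (Fin 3) (Fin 3) ℂ)) (Fin.castSucc i) pm = 0 := by
  have h2 := ne_zero_of_Q_neg (Q_col_neg C d hC hpm)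
  have hx : h⁻¹ • proj _ (Q_col_neg C d hC hpm) = x₀ := by rw [← hh, inv_smul_smul]
  have hW : W3 h⁻¹ (proj _ (Q_col_neg C d hC hpm)) =
      (((C : Matrix (Fin 3) (Fin 3) ℂ) 2 pm)⁻¹) • fun k => (mat h⁻¹ * (C : Matrix (Fin 3) (Fin 3) ℂ)) k pm := by
    rw [W3, lift_proj, Matrix.mulVec_smul]
    rfl
  have hcoord := congrArg (fun z : Ball => z.1 i) hx
  simp only [smul_val, hW, x₀_val, Pi.zero_apply, Pi.smul_apply, smul_eq_mul] at hcoord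
  rw [div_eq_zero_iff] at hcoord
  rcases hcoord with hc | hc
  · rcases mul_eq_zero.mp hc with hc | hc
    · exact absurd hc (inv_ne_zero h2)
    · exact hc
  · exfalso
    rcases mul_eq_zero.mp hc with hc | hc
    · exact inv_ne_zero h2 hc
    · -- the whole column would vanish
      have hW0 : W3 h⁻¹ (proj _ (Q_col_neg C d hC hpm)) 2 = 0 := by rw [hW, Pi.smul_apply, smul_eq_mul, hc, mul_zero]
      exact W3_2_ne_zero _ _ hW0

include hh in
/-- the last coordinate of `P e_{p₋}` is non-zero. [cite: Jacobowitz1990, Ch. 2 §1 Lemma 6] -/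
theorem transport_col_neg_apply_two_ne_zero : (mat h⁻¹ * (C : Matrix (Fin 3) (Fin 3) ℂ)) 2 pm ≠ 0 := by
  intro h0
  -- the column `p₋` of the invertible matrix `P` would vanish
  have hcol : ∀ k, (mat h⁻¹ * (C : Matrix (Fin 3) (Fin 3) ℂ)) k pm = 0 := by
    intro k; fin_cases k
    · exact transport_col_neg_apply_castSucc C d hC hpm h hh 0
    · exact transport_col_neg_apply_castSucc C d hC hpm h hh 1
    · exact h0
  have hdet : (mat h⁻¹ * (C : Matrix (Fin 3) (Fin 3) ℂ)).det ≠ 0 := by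
    rw [Matrix.det_mul]
    exact mul_ne_zero (det_mat_ne_zero _) (Matrix.det_ne_zero_of_right_inverse (B := ((C⁻¹ : GL3) : Matrix (Fin 3) (Fin 3) ℂ))
      (by rw [← Units.val_mul, mul_inv_cancel, Units.val_one]))
  apply hdet
  exact Matrix.det_eq_zero_of_column_eq_zero pm hcol

include hh in
/-- **the columns `P e_p`, `p ≠ p₋`, lie in `ℂ² × 0`**: `J`-orthogonality to `P e_{p₋} ∈ ℂ e₃`. [cite: Jacobowitz1990, Ch. 2 §1 Lemma 6] -/
theorem transport_col_apply_two {p : Fin 3} (hp : p ≠ pm) : (mat h⁻¹ * (C : Matrix (Fin 3) (Fin 3) ℂ)) 2 p = 0 := by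
  set P := mat h⁻¹ * (C : Matrix (Fin 3) (Fin 3) ℂ) with hP
  -- `Pᴴ J P = Cᴴ J C = diag d`
  have hPJP : Pᴴ * J * P = Matrix.diagonal fun p => ((d p : ℝ) : ℂ) := by
    rw [hP, Matrix.conjTranspose_mul]
    calc (C : Matrix (Fin 3) (Fin 3) ℂ)ᴴ * (mat h⁻¹)ᴴ * J * (mat h⁻¹ * (C : Matrix (Fin 3) (Fin 3) ℂ))
        = (C : Matrix (Fin 3) (Fin 3) ℂ)ᴴ * ((mat h⁻¹)ᴴ * J * mat h⁻¹) * (C : Matrix (Fin 3) (Fin 3) ℂ) := by simp only [Matrix.mul_assoc]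
      _ = _ := by rw [mat_mem, hC]
  have hentry := congrArg (fun M : Matrix (Fin 3) (Fin 3) ℂ => M p pm) hPJP
  simp only [Matrix.diagonal_apply_ne _ hp] at hentry
  have hform : (Pᴴ * J * P) p pm = star (P 0 p) * P 0 pm + star (P 1 p) * P 1 pm - star (P 2 p) * P 2 pm := by
    simp only [Matrix.mul_apply, Matrix.conjTranspose_apply, J, Matrix.diagonal_apply, Fin.sum_univ_three, Matrix.cons_val_zero,
      Matrix.cons_val_one, Matrix.cons_val]
    simp
    ring
  rw [hform, show P 0 pm = 0 from transport_col_neg_apply_castSucc C d hC hpm h hh 0,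
    show P 1 pm = 0 from transport_col_neg_apply_castSucc C d hC hpm h hh 1, mul_zero, mul_zero, zero_add, zero_sub, neg_eq_zero,
    mul_eq_zero] at hentry
  rcases hentry with h1 | h1
  · exact star_eq_zero.mp h1
  · exact absurd h1 (transport_col_neg_apply_two_ne_zero C d hC hpm h hh)

/-! ## §5 The isotropy Jacobian of `k_s` at `x₀` is diagonalised by the fixed frame `V` -/

/-- **`Jac g x₀ = (g₂₂)⁻¹ • ulBlock g` for `g ∈ Stab(x₀)`** (`diag(A, d) ↦ d⁻¹ A`). [cite: BorelWallach2000, VI 4.7] [cite: Jacobowitz1990, Ch. 2 §1 Lemma 6(2)] -/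
theorem Jac_x₀_of_smul_x₀ {g : U21} (hg : g • x₀ = x₀) : Jac g x₀ = (mat g 2 2)⁻¹ • ulBlock g := by
  have hc := mat_col_two_eq_zero_of_smul_x₀ hg
  have h22 : mat g 2 2 ≠ 0 := mat_two_two_ne_zero g
  ext i j
  simp only [Jac, Matrix.of_apply, W3_x₀, hc, zero_mul, sub_zero, Matrix.smul_apply, smul_eq_mul, ulBlock]
  field_simp

include hh in
/-- **`mat(k_s)₂₂ = s_{p₋}`**: read `mat(k_s) · P = P · diag(s)` at the entry `(2, p₋)` (`P e_{p₋} = P₂ₚ₋ e₃`, `P₂ₚ₋ ≠ 0`). [cite: BorelWallach2000, VI 4.7] -/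
theorem mat_conj_frameTorus_two_two (s : Fin 3 → ℂ) (hs : ∀ p, star (s p) * s p = 1) :
    mat (h⁻¹ * mkU21 _ (frameTorus_mem C d hC s hs) * h) 2 2 = s pm := by
  have hM := congrArg (fun M : Matrix (Fin 3) (Fin 3) ℂ => M 2 pm) (mat_conj_frameTorus_mul C d hC h s hs)
  simp only [Matrix.mul_apply (M := mat (h⁻¹ * mkU21 _ (frameTorus_mem C d hC s hs) * h)), Fin.sum_univ_three,
    Matrix.mul_diagonal] at hM
  rw [show (mat h⁻¹ * (C : Matrix (Fin 3) (Fin 3) ℂ)) 0 pm = 0 from transport_col_neg_apply_castSucc C d hC hpm h hh 0,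
    show (mat h⁻¹ * (C : Matrix (Fin 3) (Fin 3) ℂ)) 1 pm = 0 from transport_col_neg_apply_castSucc C d hC hpm h hh 1,
    mul_zero, mul_zero, zero_add, zero_add] at hM
  exact mul_right_cancel₀ (transport_col_neg_apply_two_ne_zero C d hC hpm h hh) (hM.trans (mul_comm _ _))

include hh in
/-- **`ulBlock(k_s)` acts on the truncated column `(P e_p)|_{ℂ²}`, `p ≠ p₋`, by `s_p`**: read `mat(k_s) · P = P · diag(s)` at `(i, p)`, `i < 2`, using
`P₂ₚ = 0`. [cite: BorelWallach2000, VI 4.7] -/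
theorem ulBlock_conj_frameTorus_mulVec (s : Fin 3 → ℂ) (hs : ∀ p, star (s p) * s p = 1) {p : Fin 3} (hp : p ≠ pm) :
    ulBlock (h⁻¹ * mkU21 _ (frameTorus_mem C d hC s hs) * h) *ᵥ (fun j : Fin 2 => (mat h⁻¹ * (C : Matrix (Fin 3) (Fin 3) ℂ)) (Fin.castSucc j) p) =
      s p • fun j : Fin 2 => (mat h⁻¹ * (C : Matrix (Fin 3) (Fin 3) ℂ)) (Fin.castSucc j) p := by
  have h2 := transport_col_apply_two C d hC hpm h hh hp
  funext i
  have hM := congrArg (fun M : Matrix (Fin 3) (Fin 3) ℂ => M (Fin.castSucc i) p) (mat_conj_frameTorus_mul C d hC h s hs)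
  simp only [Matrix.mul_apply (M := mat (h⁻¹ * mkU21 _ (frameTorus_mem C d hC s hs) * h)), Fin.sum_univ_three,
    Matrix.mul_diagonal] at hM
  rw [h2, mul_zero, add_zero] at hM
  simp only [Matrix.mulVec, dotProduct, Fin.sum_univ_two, ulBlock, Matrix.of_apply, Pi.smul_apply, smul_eq_mul, Fin.castSucc_zero,
    Fin.castSucc_one] at hM ⊢
  rw [hM, mul_comm]

include hh in
/-- **THE ISOTROPY JACOBIAN OF `k_s` IS DIAGONALISED BY THE FIXED FRAME**: for `p ≠ p₋`,
`Jac k_s x₀ *ᵥ (P e_p)|_{ℂ²} = (s_p · s_{p₋}⁻¹) • (P e_p)|_{ℂ²}` — eigenvector INDEPENDENT of `s`, eigenvalue `s_p / s_{p₋}`.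
[cite: BorelWallach2000, VI 4.7] [cite: Helgason1978, Ch. VIII §7] -/
theorem Jac_conj_frameTorus_mulVec (s : Fin 3 → ℂ) (hs : ∀ p, star (s p) * s p = 1) {p : Fin 3} (hp : p ≠ pm) :
    Jac (h⁻¹ * mkU21 _ (frameTorus_mem C d hC s hs) * h) x₀ *ᵥ (fun j : Fin 2 => (mat h⁻¹ * (C : Matrix (Fin 3) (Fin 3) ℂ)) (Fin.castSucc j) p) =
      (s p * (s pm)⁻¹) • fun j : Fin 2 => (mat h⁻¹ * (C : Matrix (Fin 3) (Fin 3) ℂ)) (Fin.castSucc j) p := by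
  rw [Jac_x₀_of_smul_x₀ (conj_frameTorus_smul_x₀ C d hC hpm h hh s hs), Matrix.smul_mulVec, ulBlock_conj_frameTorus_mulVec C d hC hpm h hh s hs hp,
    mat_conj_frameTorus_two_two C d hC hpm h hh s hs, smul_smul, mul_comm]

include hh in
/-- **the truncated columns `(P e_{p₁})|_{ℂ²}, (P e_{p₂})|_{ℂ²}` (`p₁ ≠ p₂`, both `≠ p₋`) form an INVERTIBLE `2 × 2` matrix** (`P` is invertible and
these columns have vanishing last coordinate). [cite: HornJohnson2013, §0.5 (nonsingularity)] -/
theorem isUnit_transport_frame {p₁ p₂ : Fin 3} (h₁ : p₁ ≠ pm) (h₂ : p₂ ≠ pm) (h12 : p₁ ≠ p₂) :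
    IsUnit (Matrix.of fun (i j : Fin 2) => (mat h⁻¹ * (C : Matrix (Fin 3) (Fin 3) ℂ)) (Fin.castSucc i) (![p₁, p₂] j)) := by
  set P := mat h⁻¹ * (C : Matrix (Fin 3) (Fin 3) ℂ) with hP
  rw [← Matrix.mulVec_injective_iff_isUnit]
  -- `P` is injective on vectors
  have hPdet : P.det ≠ 0 := by
    rw [hP, Matrix.det_mul]
    exact mul_ne_zero (det_mat_ne_zero _) (Matrix.det_ne_zero_of_right_inverse (B := ((C⁻¹ : GL3) : Matrix (Fin 3) (Fin 3) ℂ))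
      (by rw [← Units.val_mul, mul_inv_cancel, Units.val_one]))
  have hPinj : Function.Injective P.mulVec :=
    Matrix.mulVec_injective_iff_isUnit.mpr ((Matrix.isUnit_iff_isUnit_det _).mpr (isUnit_iff_ne_zero.mpr hPdet))
  intro c c' hcc'
  have hδ : (Matrix.of fun (i j : Fin 2) => P (Fin.castSucc i) (![p₁, p₂] j)) *ᵥ (c - c') = 0 := by
    rw [Matrix.mulVec_sub, hcc', sub_self]
  set u : Fin 3 → ℂ := fun k => if k = p₁ then (c - c') 0 else if k = p₂ then (c - c') 1 else 0 with hu
  have hexp : ∀ k, (P *ᵥ u) k = (c - c') 0 * P k p₁ + (c - c') 1 * P k p₂ := fun k => by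
    simp only [Matrix.mulVec, dotProduct]
    rw [Finset.sum_eq_add_of_mem p₁ p₂ (Finset.mem_univ _) (Finset.mem_univ _) h12
      (fun k' _ hk' => by rw [hu]; simp only [if_neg hk'.1, if_neg hk'.2, mul_zero])]
    rw [hu]
    simp only [if_neg (Ne.symm h12), if_true]
    ring
  have hPu : P *ᵥ u = 0 := by
    funext k
    rw [hexp, Pi.zero_apply]
    rcases Fin.eq_castSucc_or_eq_last k with ⟨i, rfl⟩ | rfl
    · have hi := congrFun hδ i
      simp only [Matrix.mulVec, dotProduct, Fin.sum_univ_two, Matrix.of_apply, Matrix.cons_val_zero, Matrix.cons_val_one, Pi.zero_apply] at hi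
      linear_combination hi
    · rw [show (Fin.last 2 : Fin 3) = 2 from rfl, show P 2 p₁ = 0 from transport_col_apply_two C d hC hpm h hh h₁,
        show P 2 p₂ = 0 from transport_col_apply_two C d hC hpm h hh h₂, mul_zero, mul_zero, add_zero]
  have hu0 : u = 0 := hPinj (by rw [hPu, Matrix.mulVec_zero])
  have h0 : (c - c') 0 = 0 := by
    have h0' := congrFun hu0 p₁
    rw [hu] at h0'
    simpa using h0'
  have h1 : (c - c') 1 = 0 := by
    have h1' := congrFun hu0 p₂
    rw [hu] at h1'
    simpa [if_neg (Ne.symm h12)] using h1'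
  funext j
  fin_cases j
  · exact sub_eq_zero.mp h0
  · exact sub_eq_zero.mp h1

include hh in
/-- **`Jac k_s x₀ * V = V * diag(s_{p₁}/s_{p₋}, s_{p₂}/s_{p₋})`**, `V` the invertible frame of `isUnit_transport_frame` — ONE frame for ALL `s`.
[cite: BorelWallach2000, VI 4.7] [cite: Helgason1978, Ch. VIII §7] -/
theorem Jac_conj_frameTorus_mul_frame (s : Fin 3 → ℂ) (hs : ∀ p, star (s p) * s p = 1) {p₁ p₂ : Fin 3} (h₁ : p₁ ≠ pm) (h₂ : p₂ ≠ pm) :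
    Jac (h⁻¹ * mkU21 _ (frameTorus_mem C d hC s hs) * h) x₀ * (Matrix.of fun (i j : Fin 2) => (mat h⁻¹ * (C : Matrix (Fin 3) (Fin 3) ℂ)) (Fin.castSucc i) (![p₁, p₂] j)) =
      (Matrix.of fun (i j : Fin 2) => (mat h⁻¹ * (C : Matrix (Fin 3) (Fin 3) ℂ)) (Fin.castSucc i) (![p₁, p₂] j)) *
        Matrix.diagonal ![s p₁ * (s pm)⁻¹, s p₂ * (s pm)⁻¹] := by
  set P := mat h⁻¹ * (C : Matrix (Fin 3) (Fin 3) ℂ) with hP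
  have hv₁ := Jac_conj_frameTorus_mulVec C d hC hpm h hh s hs h₁
  have hv₂ := Jac_conj_frameTorus_mulVec C d hC hpm h hh s hs h₂
  rw [← hP] at hv₁ hv₂
  ext i j
  rw [Matrix.mul_diagonal]
  fin_cases j
  · have hv := congrFun hv₁ i
    simp only [Matrix.mulVec, dotProduct, Pi.smul_apply, smul_eq_mul] at hv
    simp only [Matrix.mul_apply, Matrix.of_apply, Fin.zero_eta, Matrix.cons_val_zero]
    rw [hv, mul_comm]
  · have hv := congrFun hv₂ i
    simp only [Matrix.mulVec, dotProduct, Pi.smul_apply, smul_eq_mul] at hv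
    simp only [Matrix.mul_apply, Matrix.of_apply, Fin.mk_one, Matrix.cons_val_one, Matrix.cons_val_zero]
    rw [hv, mul_comm]

end Transport

/-! ## §6 Linear-algebra read-outs for the consumer -/

/-- **A common eigenvector of a simultaneously diagonalised family picks out ONE eigenvalue function**: if `A_s * V = V * diag(λ_s)` for all `s` with `V`
invertible, and `x ≠ 0` satisfies `A_s *ᵥ x = χ_s • x` for all `s`, then `χ = λ_· j` for some coordinate `j` (a non-zero coordinate of `V⁻¹ x`).
[cite: HornJohnson2013, §1.3 Def. 1.3.11 and Thm. 1.3.21 (simultaneous diagonalisation)] -/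
theorem exists_eq_eigenvalue_of_forall_mulVec_eq_smul {n S : Type} [Fintype n] [DecidableEq n] (A : S → Matrix n n ℂ) (V : Matrix n n ℂ)
    (hV : IsUnit V) (lam : S → n → ℂ) (hAV : ∀ s, A s * V = V * Matrix.diagonal (lam s)) {x : n → ℂ} (hx : x ≠ 0) (χ : S → ℂ)
    (hχ : ∀ s, A s *ᵥ x = χ s • x) : ∃ j, ∀ s, χ s = lam s j := by
  have hVdet : IsUnit V.det := (Matrix.isUnit_iff_isUnit_det V).mp hV
  set y := V⁻¹ *ᵥ x with hy
  have hxy : x = V *ᵥ y := by rw [hy, Matrix.mulVec_mulVec, Matrix.mul_nonsing_inv _ hVdet, Matrix.one_mulVec]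
  have hy0 : y ≠ 0 := fun h0 => hx (by rw [hxy, h0, Matrix.mulVec_zero])
  obtain ⟨j, hj⟩ := Function.ne_iff.mp hy0
  refine ⟨j, fun s => ?_⟩
  -- `V (diag(λ_s) y) = A_s x = χ_s x = V (χ_s y)`, and `V` is injective
  have h1 : V *ᵥ (Matrix.diagonal (lam s) *ᵥ y) = V *ᵥ (χ s • y) := by
    rw [Matrix.mulVec_mulVec, ← hAV s, ← Matrix.mulVec_mulVec, ← hxy, hχ s, Matrix.mulVec_smul, ← hxy]
  have h2 := (Matrix.mulVec_injective_iff_isUnit.mpr hV) h1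
  have h3 := congrFun h2 j
  rw [Matrix.mulVec_diagonal, Pi.smul_apply, smul_eq_mul] at h3
  exact (mul_right_cancel₀ hj h3).symm

/-- **two torus characters with integer exponents that agree on `(S¹)ⁿ` have the same exponents**: test on `ζ · e_p` with `ζ` a root of unity of order
larger than the difference of the exponents. [cite: BrockerTomDieck1985, II Prop. 8.1 (characters of tori)] -/
theorem eq_of_forall_prod_zpow_eq {n : Type} [Fintype n] [DecidableEq n] (a b : n → ℤ)
    (hab : ∀ s : n → ℂ, (∀ p, star (s p) * s p = 1) → ∏ p, s p ^ a p = ∏ p, s p ^ b p) : a = b := by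
  funext p
  by_contra hne
  set N : ℕ := (a p - b p).natAbs + 1 with hN
  have hN0 : N ≠ 0 := Nat.succ_ne_zero _
  set ζ : ℂ := Complex.exp (2 * Real.pi * Complex.I / N) with hζ
  have hζprim : IsPrimitiveRoot ζ N := Complex.isPrimitiveRoot_exp N hN0
  have hζ1 : star ζ * ζ = 1 := by
    have hn : ‖ζ‖ = 1 := hζprim.norm'_eq_one hN0
    rw [Complex.star_def, ← Complex.normSq_eq_conj_mul_self, Complex.normSq_eq_norm_sq, hn, one_pow, Complex.ofReal_one]
  have hζ0 : ζ ≠ 0 := hζprim.ne_zero hN0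
  -- test vector `s = ζ` at `p`, `1` elsewhere
  set s : n → ℂ := Function.update (fun _ => 1) p ζ with hs
  have hs1 : ∀ q, star (s q) * s q = 1 := fun q => by
    by_cases hq : q = p
    · subst hq; rw [hs, Function.update_self]; exact hζ1
    · rw [hs, Function.update_of_ne hq, star_one, one_mul]
  have key := hab s hs1
  have hprod : ∀ c : n → ℤ, ∏ q, s q ^ c q = ζ ^ c p := fun c => by
    rw [Finset.prod_eq_single p (fun q _ hq => by rw [hs, Function.update_of_ne hq, _root_.one_zpow])
      (fun h => absurd (Finset.mem_univ p) h), hs, Function.update_self]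
  rw [hprod, hprod] at key
  have hdiv : ζ ^ (a p - b p) = 1 := by rw [zpow_sub₀ hζ0, key, div_self (zpow_ne_zero _ hζ0)]
  have hdvd := (hζprim.zpow_eq_one_iff_dvd (a p - b p)).mp hdiv
  have habs : |a p - b p| < (N : ℤ) := by rw [hN]; push_cast; exact lt_add_one _
  have h0 := Int.eq_zero_of_abs_lt_dvd hdvd habs
  exact hne (sub_eq_zero.mp h0)

end BallModel

end Literature.Geometry.ComplexHyperbolic

end
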